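import Summits.QuantumFields.YangMills.Theorems.BalabanUVNodesN15TwoSpacingGluingCurvedKnitSmallFieldNodeObjects
import Summits.QuantumFields.YangMills.Theorems.BalabanUVNodesN15TwoSpacingGluingCurvedKnitCovariantAveragingTransfer
import HarnessLib

/-!
# THE GLUING STEP AT TWO LATTICE SPACINGS — PROGRAMME (P-Q), IXa: THE NE2⁺ FAMILY OBJECTS WITH BAŁABAN's COVARIANT AVERAGING SUMMAND LIVE — entry 0 := the η-defect of the glued
# propagators of the cover whose Bałaban summand is `P = N_L ⊗ 1 − N_V^Q` and whose nonlocal perturbation is `N_V^Q = a(Q*Q ⊗ 1 − Q*(U)Q(U))` (n15-c∕183, 187a, 188)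

Cell `pub-ymgap`, seat `pub-ymgap-dag-n15-c` (R134 (a); HUMAN RULING D-0062), generation 21.  `bears_on: R4∕N15 · K3⁸ SpineGivenEndpointR13SepCoPHV (stmt-QuantumFields-27366)`.
Filed `--supports stmt-QuantumFields-27366 --as helper` — COUNT-NEUTRAL.  PLUMBING definitions (3 `def`s + unfolding lemmas); 0 `sorry`.  FILE 133 (`…SmallFieldNodeObjects`: `SfIdx`, `sfGeo`,
`sfInstance`, `sfEntry0`, `sfOps`, `sfFamily`) VERBATIM with ONE change: entry 0 is the η-defect of the glued operators WITH THE COVARIANT AVERAGING SUMMAND LIVE (n15-c∕188's operator pair)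
instead of FILE 130's flat-`N_L` pair.  The carriers, the class (skew-Hermitian C² window), the pairing and the instance `sfInstance` are FILE 133's, unchanged.  Nothing in the tree is modified.

* `sfqEntry0` — entry 0: `idef P̂ P̂ (glued′(U′ = e^{η′A′}, P′ = N_L′⊗1 − N_V^Q′, N_V′ = N_V^Q′)) (glued(U = e^{ηĀ′}, P = N_L⊗1 − N_V^Q, N_V = N_V^Q))`.
* `sfqOps` (entry 0 = `sfqEntry0`, entries 1–3 the consumer's), `sfqOps_zero`, `sfqOps_of_ne_zero`; `sfqFamily` (n15-b `opFamily`), `sfqFamily_e`.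

HONEST FRAMING ∕ LIMITS.  Typing only.  MODEL operator ∕ class ∕ pairing ∕ carriers; `Q(U)` = main term (125) of [B7] (124); the Landau summand of (3.26) flat.  NE2⁺ is NOT proved here
(the sequel proves it for this family); N15 of record untouched (DISCHARGED AS CONSUMED); counts UNMOVED (typed 28∕28); one finite 𝕋⁴ at fixed ε per index — NOT infinite volume ∕ OS ∕
mass gap ∕ Clay.  Restate-immune (no Theses import).
-/

noncomputable section

open scoped BigOperators Matrix

namespace Summit.QuantumFields.YangMills.BalabanUVNodes.N15.Gluing

open Literature.MathematicalPhysics.QuantumFieldTheory.Balaban1983to89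
open Literature.MathematicalPhysics.QuantumFieldTheory.Balaban1983to89.T4EtaRateDefect (idef)
open Literature.MathematicalPhysics.QuantumFieldTheory.Balaban1983to89.T4EtaRateCoeffDefect (pull)
open Literature.MathematicalPhysics.QuantumFieldTheory.Balaban1983to89.B11SectG (BlockNorm)
open Summit.QuantumFields.YangMills.BalabanUVNodes.N15.BackgroundLayer (gavgM)
open Summit.QuantumFields.YangMills.BalabanUVNodes.N15.VectorPiece (bshiftEquiv kingPrV)
open Summit.QuantumFields.YangMills.BalabanUVNodes.N15.MatrixSpecies (liftMap liftBlk)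
open Summit.QuantumFields.YangMills.BalabanUVNodes.N15.OperatorReadout (opGeo opFamily)

variable {d : ℕ}

section Family

open scoped Matrix.Norms.L2Operator

variable (d) {L : ℕ} [NeZero L] (mm ι : Type) [Fintype mm] [DecidableEq mm] [Fintype ι] [DecidableEq ι] (a : ℝ) (e : Matrix mm mm ℂ ≃L[ℝ] (ι → ℝ))

/-- **ENTRY 0 OF THE (P-Q) FAMILY**: the η-defect along King's bond pairing between the FINE glued operator (transporters `Ad_{e^{η′A′}}`, gauges `1`, Bałaban summand `N_L′ ⊗ 1 − N_V^Q′`,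
perturbation `N_V^Q′`) and the COARSE one for the block mean `Ā′ = gavgM π̂ A′` (`N_L ⊗ 1 − N_V^Q`, `N_V^Q`) — n15-c∕188's operator pair.
[cite: Balaban1985BackgroundPropagators, (3.26) p.395, (3.42) p.397 (first entry: shape), Thm 3.14 pp.426–427 (difference template)] -/
def sfqEntry0 (hL : Odd L ∧ 1 < L) (i : SfIdx d L) (A' : Fin (d + 1) → CvX' d L i.m i.kk i.r hL → Matrix mm mm ℂ) :
    (CvX d L i.m i.kk hL × ι → ℝ) →ₗ[ℝ] (CvX' d L i.m i.kk i.r hL × ι → ℝ) :=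
  idef (pull (liftMap (kingPrV L i.kk i.r (cvM d L i.m i.kk hL)) ι)) (pull (liftMap (kingPrV L i.kk i.r (cvM d L i.m i.kk hL)) ι))
    (cvGlued' d L i.m i.kk i.r hL a ((((L ^ i.r * L ^ i.kk : ℕ) : ℝ))⁻¹) ι e (fun _ _ => (1 : Matrix mm mm ℂ)) (fun μ x' => NormedSpace.exp (((((L ^ i.r * L ^ i.kk : ℕ) : ℝ))⁻¹) • A' μ x')) (cvNL' d L i.m i.kk i.r hL a ι - (cvNVq' d L i.m i.kk i.r hL a ι e (fun μ x' => NormedSpace.exp (((((L ^ i.r * L ^ i.kk : ℕ) : ℝ))⁻¹) • A' μ x')))) (fun _ => (cvNVq' d L i.m i.kk i.r hL a ι e (fun μ x' => NormedSpace.exp (((((L ^ i.r * L ^ i.kk : ℕ) : ℝ))⁻¹) • A' μ x')))))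
    (cvGlued d L i.m i.kk hL a ((((L ^ i.kk : ℕ) : ℝ))⁻¹) ι e (fun _ _ => (1 : Matrix mm mm ℂ)) (fun μ x => NormedSpace.exp (((((L ^ i.kk : ℕ) : ℝ))⁻¹) • gavgM (Matrix mm mm ℂ) (Fin (d + 1)) (kingPrV L i.kk i.r (cvM d L i.m i.kk hL)) A' μ x)) (cvNL d L i.m i.kk hL a ι - (cvNVq d L i.m i.kk hL a ι e (fun μ x => NormedSpace.exp (((((L ^ i.kk : ℕ) : ℝ))⁻¹) • gavgM (Matrix mm mm ℂ) (Fin (d + 1)) (kingPrV L i.kk i.r (cvM d L i.m i.kk hL)) A' μ x)))) (fun _ => (cvNVq d L i.m i.kk hL a ι e (fun μ x => NormedSpace.exp (((((L ^ i.kk : ℕ) : ℝ))⁻¹) • gavgM (Matrix mm mm ℂ) (Fin (d + 1)) (kingPrV L i.kk i.r (cvM d L i.m i.kk hL)) A' μ x)))))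

/-- THE FOUR ENTRY OPERATORS: entry 0 = `sfqEntry0`; entries 1–3 = the consumer's `E 1, E 2, E 3`. [cite: Balaban1985BackgroundPropagators, (3.42) p.397 (the four entries: shape)] -/
def sfqOps (hL : Odd L ∧ 1 < L) (i : SfIdx d L) (E : Fin 4 → (Fin (d + 1) → CvX' d L i.m i.kk i.r hL → Matrix mm mm ℂ) → ((CvX d L i.m i.kk hL × ι → ℝ) →ₗ[ℝ] (CvX' d L i.m i.kk i.r hL × ι → ℝ))) :
    Fin 4 → (Fin (d + 1) → CvX' d L i.m i.kk i.r hL → Matrix mm mm ℂ) → ((CvX d L i.m i.kk hL × ι → ℝ) →ₗ[ℝ] (CvX' d L i.m i.kk i.r hL × ι → ℝ)) :=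
  fun n A' => ![sfqEntry0 d mm ι a e hL i A', E 1 A', E 2 A', E 3 A'] n

/-- Unfolding: entry 0. [folklore] -/
@[simp] theorem sfqOps_zero (hL : Odd L ∧ 1 < L) (i : SfIdx d L) (E : Fin 4 → (Fin (d + 1) → CvX' d L i.m i.kk i.r hL → Matrix mm mm ℂ) → ((CvX d L i.m i.kk hL × ι → ℝ) →ₗ[ℝ] (CvX' d L i.m i.kk i.r hL × ι → ℝ)))
    (A' : Fin (d + 1) → CvX' d L i.m i.kk i.r hL → Matrix mm mm ℂ) : sfqOps d mm ι a e hL i E 0 A' = sfqEntry0 d mm ι a e hL i A' := rfl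

/-- Unfolding: every entry other than entry 0 is the consumer's. [folklore] -/
theorem sfqOps_of_ne_zero (hL : Odd L ∧ 1 < L) (i : SfIdx d L) (E : Fin 4 → (Fin (d + 1) → CvX' d L i.m i.kk i.r hL → Matrix mm mm ℂ) → ((CvX d L i.m i.kk hL × ι → ℝ) →ₗ[ℝ] (CvX' d L i.m i.kk i.r hL × ι → ℝ)))
    {n : Fin 4} (hn : n ≠ 0) (A' : Fin (d + 1) → CvX' d L i.m i.kk i.r hL → Matrix mm mm ℂ) : sfqOps d mm ι a e hL i E n A' = E n A' := by
  fin_cases n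
  · exact absurd rfl hn
  all_goals rfl

/-- THE KERNEL FAMILY of the index for the (P-Q) entries (n15-b `opFamily` on the product carriers: coarse blocks `liftBlk cvBlk ι`, fine blocks through King's pairing).
[cite: Balaban1985BackgroundPropagators, (3.42) p.397 (shape)] -/
def sfqFamily (hL : Odd L ∧ 1 < L) (i : SfIdx d L) (E : Fin 4 → (Fin (d + 1) → CvX' d L i.m i.kk i.r hL → Matrix mm mm ℂ) → ((CvX d L i.m i.kk hL × ι → ℝ) →ₗ[ℝ] (CvX' d L i.m i.kk i.r hL × ι → ℝ))) :
    B9.KernelFamily (sfInstance d mm ι hL i).gc (sfInstance d mm ι hL i).Bf :=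
  show B9.KernelFamily (opGeo (sfGeo d hL i) (CvX d L i.m i.kk hL × ι) (liftBlk (cvBlk d L i.m i.kk hL) ι))
      (sfGaugeBg mm (Fin (d + 1)) (fun μ => bshiftEquiv (cvM d L i.m i.kk hL) (L ^ i.r * L ^ i.kk) μ) ((sfGeo d hL i).eta * ((sfGeo d hL i).L ^ i.r)⁻¹) (sfGeo d hL i).M) from
    opFamily (g := sfGeo d hL i) (liftBlk (cvBlk d L i.m i.kk hL) ι) (liftBlk (cvBlk d L i.m i.kk hL ∘ kingPrV L i.kk i.r (cvM d L i.m i.kk hL)) ι) (sfqOps d mm ι a e hL i E)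

/-- Unfolding of the entries: the sharp fine-cube sup of the entry operator applied to the test function. [folklore] -/
theorem sfqFamily_e (hL : Odd L ∧ 1 < L) (i : SfIdx d L) (E : Fin 4 → (Fin (d + 1) → CvX' d L i.m i.kk i.r hL → Matrix mm mm ℂ) → ((CvX d L i.m i.kk hL × ι → ℝ) →ₗ[ℝ] (CvX' d L i.m i.kk i.r hL × ι → ℝ)))
    (n : Fin 4) (A' : Fin (d + 1) → CvX' d L i.m i.kk i.r hL → Matrix mm mm ℂ) (lam : CvX d L i.m i.kk hL × ι → ℝ) (y : (sfGeo d hL i).Site) :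
    (sfqFamily d mm ι a e hL i E).e n A' lam y =
      (BlockNorm.ofBlocks (sfGeo d hL i) (liftBlk (cvBlk d L i.m i.kk hL ∘ kingPrV L i.kk i.r (cvM d L i.m i.kk hL)) ι)).loc y (sfqOps d mm ι a e hL i E n A' lam) := rfl

end Family

end Summit.QuantumFields.YangMills.BalabanUVNodes.N15.Gluing

end
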